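import Mathlib.AlgebraicGeometry.EllipticCurve.VariableChange
import HarnessLib

/-!
# Rigidity of Kubert's level-`7` normal form (Kubert 1976, Table 3; Silverman, *AEC* III.10)

Topic `NumberTheory/EllipticCurves`; a PROOFS file (theorems only, no `def`, no named fact; net
debt `0`). File 1 of 4 of the `Literature/` PORT of the tree's proved level-`49` theorem of Kenku
(no elliptic curve over `ℚ` has a rational cyclic `49`-isogeny — the `n = 49` leaf of Mazur's
"First reduction", named fact
`Literature.NumberTheory.EllipticCurves.Mazur1977_reduction_to_primes`).

PORT. Source (PROVED, Summits-side, read-only here):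
`Summits/ABC/ABC/Theorems/IsogenyGlueCongruenceMazurKenkuBoundStubKubertSevenRigidity.lean`
(proposal p173095, route `IsogenyGlueCongruence`, crux `MazurKenkuBound`; sha256 in the `-- PORT:`
line 1). Ported declarations, 1 : 1, statements and tactic scripts VERBATIM, namespace
`Summit.ABC.ABC.Theorems` ↦ `Literature.NumberTheory.EllipticCurves`, names unchanged except that
the crux prefix `stub_` is dropped: `kubertSeven_r_eq_zero_of_smul_eq_self`,
`kubertSeven_r_eq_of_smul_eq`, `kubertSeven_r_eq_of_smul_eq_smul`, `kubertSeven_scale`,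
`kubertSeven_renorm_two`, `kubertSeven_renorm_three`, `kubertSeven_orbit`,
`stub_kubertSevenRigidity` ↦ `kubertSevenRigidity`. Nothing is re-stated beyond this renaming (a
`Literature/` file may not import `Summits.*`, CONVENTIONS §2, so the Summits twins cannot be
re-used by `import`); the Summits files are untouched. Ported by bsd-cited-r19 (ARM P lead ruling
(452)(a), OPS 2026-08-27T09:49Z).

WHAT. Kubert's universal curve over `X₁(7)` (Kubert 1976, Table 3: `E(b, c)` with `b = d³ - d²`,
`c = d² - d`), scaled by `u`, is the Weierstrass equation
`Kub(d, u) = [u(1 - d(d-1)), -u²d²(d-1), -u³d²(d-1), 0, 0]`, with `P₀ = (0, 0)` of order `7`,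
`2P₀ = (u²d²(d-1), u³d³(d-1)²)`, `3P₀ = (u²d(d-1), u³d(d-1)²)`. Suppose two changes of
variables `C, C'` with `u`-component `1` put one equation `E` over a field of characteristic `0`
with `c₄(E) ≠ 0`, `c₆(E) ≠ 0` into the forms `Kub(d, u)` and `Kub(d', u')`, and the level-`7`
Hauptmodul `η(z) = (z³ - 8z² + 5z + 1)/(z(z-1))` takes the same value at `d` and `d'`. Then
`C'.r - C.r ∈ {0, u²d²(d-1), u²d(d-1)} = {x(P₀), x(2P₀), x(3P₀)}`: the point that `C'` moves to
the origin is `± P₀`, `± 2P₀` or `± 3P₀` of the first normalisation.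

PROOF (every identity below is closed by `ring` / `field_simp` / `linear_combination`).
* ORBIT (`kubertSeven_orbit`): the `η`-equality factors as
  `(d' - d)((1 - d)d' - 1)(dd' - (d - 1)) = 0`, so `d' ∈ {d, (d-1)/d, 1/(1-d)}` — the orbit of
  the deck transformation `d ↦ 1/(1-d)` of `X₁(7) → X₀(7)`.
* RE-NORMALISATION (`kubertSeven_renorm_two`, `kubertSeven_renorm_three`): the `u = 1` changes
  `D₁ = (1, u²d²(d-1), u(d²-1), u³d³(d-1)²)` (tangent normalisation at `2P₀`) and
  `D₂ = (1, u²d(d-1), u(d-1), u³d(d-1)²)` (tangent normalisation at `3P₀`) carry `Kub(d, u)` to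
  `Kub((d-1)/d, ud²)` and to `Kub(1/(1-d), -u(d-1)²)`.
* SCALING (`kubertSeven_scale`): `Kub(δ, μ') = (μ/μ', 0, 0, 0) • Kub(δ, μ)`.
* RIGIDITY (`kubertSeven_r_eq_zero_of_smul_eq_self`): if `M • W = W` and `c₄(W), c₆(W) ≠ 0`
  then `v = M.u⁻¹` has `v⁴ = v⁶ = 1`, so `v² = 1`, and comparing `a₁, a₂` gives
  `12·M.r = (v² - 1)a₁² = 0` (Silverman, *AEC* III.10: an equation with `j ≠ 0, 1728` has only
  the automorphisms `u = ±1, r = 0`).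
* ASSEMBLY (`kubertSeven_r_eq_of_smul_eq`, `kubertSeven_r_eq_of_smul_eq_smul`): if
  `A.u = B.u = 1`, `S.r = 0` and `B • E = S • A • E` then `M = S⁻¹BA⁻¹` fixes `A • E`, so
  `0 = M.r = B.r - A.r`. Apply with `B = C'` and `A = C`, `D₁C`, `D₂C` in the three cases of the
  orbit; `(D_kC).r = C.r + D_k.r`.

Only Mathlib's `WeierstrassCurve.VariableChange` API is used (`variableChange_a₁, …, _c₆`,
`VariableChange.mul_def`, `inv_def`, the `MulAction` instance); no named fact.

## References

* [Kubert1976] D. S. Kubert, *Universal bounds on the torsion of elliptic curves*, Proc. London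
  Math. Soc. (3) 33 (1976) 193–237, Table 3 (the form `E(b, c)` of `X₁(7)`).
* [SilvermanAEC2009] J. H. Silverman, *The Arithmetic of Elliptic Curves*, 2nd ed., GTM 106
  (2009), III.1 Table 3.1 (changes of variables), III.10 Thm. 10.1 (automorphism groups).
* [Kenku1982] M. A. Kenku, *On the number of `ℚ`-isomorphism classes of elliptic curves in each
  `ℚ`-isogeny class*, J. Number Theory 15 (1982) 199–202, proof of Thm. 1, p. 200 (the consumer:
  level `49`, file `KenkuLevelFortyNineProofs`).
-/

noncomputable section

open scoped Classical

open WeierstrassCurve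

namespace Literature.NumberTheory.EllipticCurves

variable {L : Type*} [Field L]

/-- **Rigidity of a Weierstrass equation with `c₄c₆ ≠ 0`.** Over a field of characteristic `0`,
if a change of variables `M = (u, r, s, t)` fixes an equation `W` with `c₄(W) ≠ 0` and
`c₆(W) ≠ 0`, then `M.r = 0`. Indeed `c₄ = u⁻⁴c₄` and `c₆ = u⁻⁶c₆` give `u⁻⁴ = u⁻⁶ = 1`, hence
`v := u⁻¹` has `v² = 1`; then `a₁ = v(a₁ + 2s)` gives `2s = (v - 1)a₁` and
`a₂ = v²(a₂ - sa₁ + 3r - s²)` gives `3r = s(a₁ + s)`, so `12r = (v - 1)(v + 1)a₁² = 0`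
(Silverman, *AEC* III.10, Thm. 10.1: `Aut(E) = {±1}` for `j ≠ 0, 1728`).
[cite: SilvermanAEC2009, III.10 Thm. 10.1] -/
theorem kubertSeven_r_eq_zero_of_smul_eq_self [CharZero L] {W : WeierstrassCurve L}
    {M : VariableChange L} (h4 : W.c₄ ≠ 0) (h6 : W.c₆ ≠ 0) (hM : M • W = W) : M.r = 0 := by
  have hc4 : (M • W).c₄ = W.c₄ := by rw [hM]
  have hc6 : (M • W).c₆ = W.c₆ := by rw [hM]
  have ha1 : (M • W).a₁ = W.a₁ := by rw [hM]
  have ha2 : (M • W).a₂ = W.a₂ := by rw [hM]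
  rw [variableChange_c₄] at hc4
  rw [variableChange_c₆] at hc6
  rw [variableChange_a₁] at ha1
  rw [variableChange_a₂] at ha2
  set v : L := ((M.u⁻¹ : Lˣ) : L)
  have hv4 : v ^ 4 = 1 := by
    have h0 : (v ^ 4 - 1) * W.c₄ = 0 := by linear_combination hc4
    linear_combination (mul_eq_zero.1 h0).resolve_right h4
  have hv6 : v ^ 6 = 1 := by
    have h0 : (v ^ 6 - 1) * W.c₆ = 0 := by linear_combination hc6
    linear_combination (mul_eq_zero.1 h0).resolve_right h6
  have hv2 : v ^ 2 = 1 := by linear_combination hv6 - v ^ 2 * hv4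
  have E1 : 3 * M.r = M.s * W.a₁ + M.s ^ 2 := by
    linear_combination ha2 - (W.a₂ - M.s * W.a₁ + 3 * M.r - M.s ^ 2) * hv2
  have E2 : 2 * M.s = (v - 1) * W.a₁ := by
    linear_combination v * ha1 - (W.a₁ + 2 * M.s) * hv2
  have h12 : (12 : L) * M.r = 0 := by
    linear_combination 4 * E1 + (2 * M.s + (v + 1) * W.a₁) * E2 + W.a₁ ^ 2 * hv2
  exact (mul_eq_zero.1 h12).resolve_left (by norm_num)

/-- **Two `u = 1` normalisations of one equation that differ by a scaling have the same
translation.** If `A.u = B.u = 1`, `S.r = 0` and `B • E = S • (A • E)` for an equation `E` with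
`c₄(E) ≠ 0`, `c₆(E) ≠ 0` over a field of characteristic `0`, then `B.r = A.r`: the change
`M = S⁻¹ B A⁻¹` fixes `A • E` (whose `c₄, c₆` are those of `E`), so `M.r = 0` by rigidity, and
`M.r = B.r - A.r` by the composition law of changes of variables (Silverman, *AEC* III.1,
Table 3.1 and III.10). [cite: SilvermanAEC2009, III.10 Thm. 10.1] -/
theorem kubertSeven_r_eq_of_smul_eq [CharZero L] {E : WeierstrassCurve L}
    {A B S : VariableChange L} (h4 : E.c₄ ≠ 0) (h6 : E.c₆ ≠ 0) (h : B • E = S • A • E)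
    (hA : A.u = 1) (hB : B.u = 1) (hS : S.r = 0) : B.r = A.r := by
  have key : (S⁻¹ * B * A⁻¹) • A • E = A • E := by
    rw [mul_smul, inv_smul_smul, mul_smul, h, inv_smul_smul]
  have h4' : (A • E).c₄ ≠ 0 := by
    rwa [variableChange_c₄, hA, inv_one, Units.val_one, one_pow, one_mul]
  have h6' : (A • E).c₆ ≠ 0 := by
    rwa [variableChange_c₆, hA, inv_one, Units.val_one, one_pow, one_mul]
  have hr := kubertSeven_r_eq_zero_of_smul_eq_self h4' h6' key
  simp only [VariableChange.mul_def, VariableChange.inv_def, hA, hB, hS, inv_one, Units.val_one,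
    one_pow, mul_one, neg_zero, zero_mul, zero_add] at hr
  linear_combination hr

/-- **The same with an intermediate `u = 1` change.** If `A.u = D.u = B.u = 1`, `S.r = 0` and
`B • E = S • (D • (A • E))` for an equation `E` with `c₄(E) ≠ 0`, `c₆(E) ≠ 0` over a field of
characteristic `0`, then `B.r = A.r + D.r` (`(DA).r = D.r·A.u² + A.r`; Silverman, *AEC* III.1,
Table 3.1 and III.10). [cite: SilvermanAEC2009, III.10 Thm. 10.1] -/
theorem kubertSeven_r_eq_of_smul_eq_smul [CharZero L] {E : WeierstrassCurve L}
    {A D B S : VariableChange L} (h4 : E.c₄ ≠ 0) (h6 : E.c₆ ≠ 0) (h : B • E = S • D • A • E)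
    (hA : A.u = 1) (hD : D.u = 1) (hB : B.u = 1) (hS : S.r = 0) : B.r = A.r + D.r := by
  rw [smul_smul D A] at h
  have hDA : (D * A).u = 1 := by
    simp only [VariableChange.mul_def, hA, hD, mul_one]
  rw [kubertSeven_r_eq_of_smul_eq h4 h6 h hDA hB hS]
  simp only [VariableChange.mul_def, hA, Units.val_one, one_pow, mul_one]
  ring

/-- **Scaling of Kubert forms.** Two Kubert level-`7` forms
`Kub(δ, μ) = [μ(1 - δ(δ-1)), -μ²δ²(δ-1), -μ³δ²(δ-1), 0, 0]` and `Kub(δ, μ')` with the same Tate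
parameter `δ` and `μ, μ' ≠ 0` differ by the scaling `(μ/μ', 0, 0, 0)`:
`Kub(δ, μ') = (μ/μ', 0, 0, 0) • Kub(δ, μ)` (`aᵢ ↦ (μ'/μ)ⁱ aᵢ`, Silverman, *AEC* III.1, Table 3.1).
[cite: SilvermanAEC2009, III.1 Table 3.1] -/
theorem kubertSeven_scale {W W' : WeierstrassCurve L} {δ μ μ' : L} (hμ : μ ≠ 0) (hμ' : μ' ≠ 0)
    (h1 : W.a₁ = μ * (1 - δ * (δ - 1))) (h2 : W.a₂ = -(μ ^ 2 * (δ ^ 2 * (δ - 1))))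
    (h3 : W.a₃ = -(μ ^ 3 * (δ ^ 2 * (δ - 1)))) (h4 : W.a₄ = 0) (h6 : W.a₆ = 0)
    (h1' : W'.a₁ = μ' * (1 - δ * (δ - 1))) (h2' : W'.a₂ = -(μ' ^ 2 * (δ ^ 2 * (δ - 1))))
    (h3' : W'.a₃ = -(μ' ^ 3 * (δ ^ 2 * (δ - 1)))) (h4' : W'.a₄ = 0) (h6' : W'.a₆ = 0) :
    W' = (⟨Units.mk0 (μ / μ') (div_ne_zero hμ hμ'), 0, 0, 0⟩ : VariableChange L) • W := by
  ext
  · simp only [variableChange_a₁, Units.val_inv_eq_inv_val, Units.val_mk0, inv_div, h1, h1']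
    field_simp
    ring
  · simp only [variableChange_a₂, Units.val_inv_eq_inv_val, Units.val_mk0, inv_div, h1, h2, h2']
    field_simp
    ring
  · simp only [variableChange_a₃, Units.val_inv_eq_inv_val, Units.val_mk0, inv_div, h1, h3, h3']
    field_simp
    ring
  · simp only [variableChange_a₄, Units.val_inv_eq_inv_val, Units.val_mk0, inv_div, h1, h2, h3,
      h4, h4']
    ring
  · simp only [variableChange_a₆, Units.val_inv_eq_inv_val, Units.val_mk0, inv_div, h1, h2, h3,
      h4, h6, h6']
    ring

/-- **Re-normalisation at `2P₀`.** On the Kubert form `K = Kub(d, u)` (`d ≠ 0`) the tangent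
normalisation `D₁ = (1, x(2P₀), λ, y(2P₀)) = (1, u²d²(d-1), u(d²-1), u³d³(d-1)²)` at
`2P₀ = (u²d²(d-1), u³d³(d-1)²)` (tangent slope `λ = u(d²-1)`) produces the Kubert form with Tate
parameter `(d-1)/d` and scale `ud²`: `D₁ • K = Kub((d-1)/d, ud²)`, i.e. its coefficients are
`[ud²(1 - δ(δ-1)), -(ud²)²δ²(δ-1), -(ud²)³δ²(δ-1), 0, 0]` with `δ = (d-1)/d` (Kubert 1976, Table 3;
the deck transformation of `X₁(7) → X₀(7)`). [cite: Kubert1976, Table 3] -/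
theorem kubertSeven_renorm_two {K : WeierstrassCurve L} {d u : L} (hd : d ≠ 0)
    (h1 : K.a₁ = u * (1 - d * (d - 1))) (h2 : K.a₂ = -(u ^ 2 * (d ^ 2 * (d - 1))))
    (h3 : K.a₃ = -(u ^ 3 * (d ^ 2 * (d - 1)))) (h4 : K.a₄ = 0) (h6 : K.a₆ = 0) :
    ((⟨1, u ^ 2 * (d ^ 2 * (d - 1)), u * (d ^ 2 - 1), u ^ 3 * d ^ 3 * (d - 1) ^ 2⟩ :
        VariableChange L) • K).a₁ = u * d ^ 2 * (1 - (d - 1) / d * ((d - 1) / d - 1)) ∧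
    ((⟨1, u ^ 2 * (d ^ 2 * (d - 1)), u * (d ^ 2 - 1), u ^ 3 * d ^ 3 * (d - 1) ^ 2⟩ :
        VariableChange L) • K).a₂ = -((u * d ^ 2) ^ 2 * (((d - 1) / d) ^ 2 * ((d - 1) / d - 1))) ∧
    ((⟨1, u ^ 2 * (d ^ 2 * (d - 1)), u * (d ^ 2 - 1), u ^ 3 * d ^ 3 * (d - 1) ^ 2⟩ :
        VariableChange L) • K).a₃ = -((u * d ^ 2) ^ 3 * (((d - 1) / d) ^ 2 * ((d - 1) / d - 1))) ∧
    ((⟨1, u ^ 2 * (d ^ 2 * (d - 1)), u * (d ^ 2 - 1), u ^ 3 * d ^ 3 * (d - 1) ^ 2⟩ :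
        VariableChange L) • K).a₄ = 0 ∧
    ((⟨1, u ^ 2 * (d ^ 2 * (d - 1)), u * (d ^ 2 - 1), u ^ 3 * d ^ 3 * (d - 1) ^ 2⟩ :
        VariableChange L) • K).a₆ = 0 := by
  refine ⟨?_, ?_, ?_, ?_, ?_⟩
  · simp only [variableChange_a₁, inv_one, Units.val_one, one_mul, h1]
    field_simp
    ring
  · simp only [variableChange_a₂, inv_one, Units.val_one, one_pow, one_mul, h1, h2]
    field_simp
    ring
  · simp only [variableChange_a₃, inv_one, Units.val_one, one_pow, one_mul, h1, h3]
    field_simp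
    ring
  · simp only [variableChange_a₄, inv_one, Units.val_one, one_pow, one_mul, h1, h2, h3, h4]
    ring
  · simp only [variableChange_a₆, inv_one, Units.val_one, one_pow, one_mul, h1, h2, h3, h4, h6]
    ring

/-- **Re-normalisation at `3P₀`.** On the Kubert form `K = Kub(d, u)` (`d ≠ 1`) the tangent
normalisation `D₂ = (1, x(3P₀), λ, y(3P₀)) = (1, u²d(d-1), u(d-1), u³d(d-1)²)` at
`3P₀ = (u²d(d-1), u³d(d-1)²)` (tangent slope `λ = u(d-1)`) produces the Kubert form with Tate
parameter `1/(1-d)` and scale `-u(d-1)²`: `D₂ • K = Kub(1/(1-d), -u(d-1)²)`, i.e. its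
coefficients are `[μ(1 - δ(δ-1)), -μ²δ²(δ-1), -μ³δ²(δ-1), 0, 0]` with `δ = 1/(1-d)`,
`μ = -u(d-1)²` (Kubert 1976, Table 3; the square of the deck transformation of `X₁(7) → X₀(7)`).
[cite: Kubert1976, Table 3] -/
theorem kubertSeven_renorm_three {K : WeierstrassCurve L} {d u : L} (hd : d - 1 ≠ 0)
    (h1 : K.a₁ = u * (1 - d * (d - 1))) (h2 : K.a₂ = -(u ^ 2 * (d ^ 2 * (d - 1))))
    (h3 : K.a₃ = -(u ^ 3 * (d ^ 2 * (d - 1)))) (h4 : K.a₄ = 0) (h6 : K.a₆ = 0) :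
    ((⟨1, u ^ 2 * (d * (d - 1)), u * (d - 1), u ^ 3 * d * (d - 1) ^ 2⟩ :
        VariableChange L) • K).a₁ = -(u * (d - 1) ^ 2) * (1 - 1 / (1 - d) * (1 / (1 - d) - 1)) ∧
    ((⟨1, u ^ 2 * (d * (d - 1)), u * (d - 1), u ^ 3 * d * (d - 1) ^ 2⟩ :
        VariableChange L) • K).a₂ =
      -((-(u * (d - 1) ^ 2)) ^ 2 * ((1 / (1 - d)) ^ 2 * (1 / (1 - d) - 1))) ∧
    ((⟨1, u ^ 2 * (d * (d - 1)), u * (d - 1), u ^ 3 * d * (d - 1) ^ 2⟩ :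
        VariableChange L) • K).a₃ =
      -((-(u * (d - 1) ^ 2)) ^ 3 * ((1 / (1 - d)) ^ 2 * (1 / (1 - d) - 1))) ∧
    ((⟨1, u ^ 2 * (d * (d - 1)), u * (d - 1), u ^ 3 * d * (d - 1) ^ 2⟩ :
        VariableChange L) • K).a₄ = 0 ∧
    ((⟨1, u ^ 2 * (d * (d - 1)), u * (d - 1), u ^ 3 * d * (d - 1) ^ 2⟩ :
        VariableChange L) • K).a₆ = 0 := by
  have hd' : (1 : L) - d ≠ 0 := fun h0 => hd (by linear_combination -h0)
  refine ⟨?_, ?_, ?_, ?_, ?_⟩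
  · simp only [variableChange_a₁, inv_one, Units.val_one, one_mul, h1]
    field_simp
    ring
  · simp only [variableChange_a₂, inv_one, Units.val_one, one_pow, one_mul, h1, h2]
    field_simp
    ring
  · simp only [variableChange_a₃, inv_one, Units.val_one, one_pow, one_mul, h1, h3]
    field_simp
    ring
  · simp only [variableChange_a₄, inv_one, Units.val_one, one_pow, one_mul, h1, h2, h3, h4]
    ring
  · simp only [variableChange_a₆, inv_one, Units.val_one, one_pow, one_mul, h1, h2, h3, h4, h6]
    ring

/-- **The deck orbit.** If the level-`7` Hauptmodul `η(z) = (z³ - 8z² + 5z + 1)/(z(z - 1))`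
(cleared of denominators) takes the same value at `d` and `d'`, `d(d-1) ≠ 0`, then
`d' ∈ {d, (d-1)/d, 1/(1-d)}`: the difference factors as
`(η-equality) = -(d' - d)((1 - d)d' - 1)(dd' - (d - 1))`, the orbit of the order-`3` deck
transformation `d ↦ 1/(1 - d)` of `X₁(7) → X₀(7)` (Kubert 1976, Table 3). [cite: Kubert1976, Table 3] -/
theorem kubertSeven_orbit {d d' : L} (hd : d * (d - 1) ≠ 0)
    (h : (d ^ 3 - 8 * d ^ 2 + 5 * d + 1) * (d' * (d' - 1)) =
      (d' ^ 3 - 8 * d' ^ 2 + 5 * d' + 1) * (d * (d - 1))) :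
    d' = d ∨ d' = (d - 1) / d ∨ d' = 1 / (1 - d) := by
  have hd0 : d ≠ 0 := fun h0 => hd (by rw [h0, zero_mul])
  have hd1 : (1 : L) - d ≠ 0 := fun h0 => hd (by linear_combination (-d) * h0)
  have key : (d' - d) * ((1 - d) * d' - 1) * (d * d' - (d - 1)) = 0 := by linear_combination h
  rcases mul_eq_zero.1 key with h' | h'
  · rcases mul_eq_zero.1 h' with h'' | h''
    · exact Or.inl (by linear_combination h'')
    · refine Or.inr (Or.inr ?_)
      rw [eq_div_iff hd1]
      linear_combination h''
  · refine Or.inr (Or.inl ?_)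
    rw [eq_div_iff hd0]
    linear_combination h'

/-- **Rigidity of Kubert's level-`7` normal forms** (PORT of the Summits-side
`Summit.ABC.ABC.Theorems.stub_kubertSevenRigidity`, p173095, statement verbatim). If two `u = 1`
changes of variables `C, C'` put the same Weierstrass equation `E` (`c₄c₆ ≠ 0`,
characteristic `0`) into Kubert forms `[u(1 - d(d-1)), -u²d²(d-1), -u³d²(d-1), 0, 0]` and
`[u'(…d'…), …]` whose Tate parameters have the same Hauptmodul value
(`(d³-8d²+5d+1)·d'(d'-1) = (d'³-8d'²+5d'+1)·d(d-1)`), then the two translations differ by `0`,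
`x(2P₀) = u²d²(d-1)` or `x(3P₀) = u²d(d-1)`: `d' ∈ {d, (d-1)/d, 1/(1-d)}` (`kubertSeven_orbit`), the deck transformation is realised by re-normalising at `2P₀`
/ `3P₀` (`kubertSeven_renorm_two/three`), two Kubert forms with the same parameter differ by a
scaling (`kubertSeven_scale`), and a self-equivalence of an equation with `c₄c₆ ≠ 0` has `r = 0`
(`kubertSeven_r_eq_of_smul_eq_smul`). The hypothesis `d'(d'-1) ≠ 0` is not used.
[cite: Kubert1976, Table 3] [cite: SilvermanAEC2009, III.1 Table 3.1 and III.10] -/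
theorem kubertSevenRigidity :
    ∀ {L : Type} [Field L] [CharZero L] (E : WeierstrassCurve L) (C C' : VariableChange L)
      (u d u' d' : L),
      C.u = 1 → C'.u = 1 →
      (C • E).a₁ = u * (1 - d * (d - 1)) → (C • E).a₂ = -(u ^ 2 * (d ^ 2 * (d - 1))) →
      (C • E).a₃ = -(u ^ 3 * (d ^ 2 * (d - 1))) → (C • E).a₄ = 0 → (C • E).a₆ = 0 →
      (C' • E).a₁ = u' * (1 - d' * (d' - 1)) → (C' • E).a₂ = -(u' ^ 2 * (d' ^ 2 * (d' - 1))) →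
      (C' • E).a₃ = -(u' ^ 3 * (d' ^ 2 * (d' - 1))) → (C' • E).a₄ = 0 → (C' • E).a₆ = 0 →
      u ≠ 0 → u' ≠ 0 → d * (d - 1) ≠ 0 → d' * (d' - 1) ≠ 0 →
      (d ^ 3 - 8 * d ^ 2 + 5 * d + 1) * (d' * (d' - 1)) =
        (d' ^ 3 - 8 * d' ^ 2 + 5 * d' + 1) * (d * (d - 1)) →
      E.c₄ ≠ 0 → E.c₆ ≠ 0 →
      C'.r = C.r ∨ C'.r = C.r + u ^ 2 * (d ^ 2 * (d - 1)) ∨ C'.r = C.r + u ^ 2 * (d * (d - 1)) := by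
  intro L _ _ E C C' u d u' d' hC hC' h1 h2 h3 h4 h6 h1' h2' h3' h4' h6' hu hu' hd _ hη hc4 hc6
  have hd0 : d ≠ 0 := fun h0 => hd (by rw [h0, zero_mul])
  have hd1 : d - 1 ≠ 0 := fun h0 => hd (by rw [h0, mul_zero])
  rcases kubertSeven_orbit hd hη with h | h | h
  · -- `d' = d`: the two Kubert forms differ by a scaling
    subst h
    exact Or.inl (kubertSeven_r_eq_of_smul_eq hc4 hc6
      (kubertSeven_scale hu hu' h1 h2 h3 h4 h6 h1' h2' h3' h4' h6') hC hC' rfl)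
  · -- `d' = (d-1)/d`: re-normalise the first form at `2P₀`
    subst h
    obtain ⟨k1, k2, k3, k4, k6⟩ := kubertSeven_renorm_two hd0 h1 h2 h3 h4 h6
    have hμ : u * d ^ 2 ≠ 0 := mul_ne_zero hu (pow_ne_zero 2 hd0)
    exact Or.inr (Or.inl (kubertSeven_r_eq_of_smul_eq_smul hc4 hc6
      (kubertSeven_scale hμ hu' k1 k2 k3 k4 k6 h1' h2' h3' h4' h6') hC rfl hC' rfl))
  · -- `d' = 1/(1-d)`: re-normalise the first form at `3P₀`
    subst h
    obtain ⟨k1, k2, k3, k4, k6⟩ := kubertSeven_renorm_three hd1 h1 h2 h3 h4 h6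
    have hμ : -(u * (d - 1) ^ 2) ≠ 0 := neg_ne_zero.mpr (mul_ne_zero hu (pow_ne_zero 2 hd1))
    exact Or.inr (Or.inr (kubertSeven_r_eq_of_smul_eq_smul hc4 hc6
      (kubertSeven_scale hμ hu' k1 k2 k3 k4 k6 h1' h2' h3' h4' h6') hC rfl hC' rfl))

end Literature.NumberTheory.EllipticCurves

end
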